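import Summits.ResolutionOfSingularities.ResolutionOfSingularities.Theorems.FrobeniusClosingPatchingRelPerfectDepthMultiHostFormat
import HarnessLib

/-!
# Crux `PatchingRelPerfect` (stmt-ResolutionOfSingularities-16161), chain W5.2 — F7(β) d = 2 (β-AX), X2a module 1:
# the CYLINDER STATE `CylState` over a multi-host state

[OURS · L1 W5.2 · F7(β) (β-AX) X-side · res-D-pv-016 AS res-L1-w52-stub-5 per res-L1-w52-plan-1 NAMING G11-8 (1) 2026-08-27T15:23:55Z and
ASSEMBLY SPEC v4 `L/res-L1-w52-plan-1/F7BETA-ASSEMBLY-SPEC.md` (88daa5a2a9f23770) §1 (O3)/(O6), §2 T2a.]  Replaces the role of NO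
printed item; NOT a statement of the manuscript under review; fact-free.  AI-written; AI review is weaker than expert review.  OURS
definitions (statement-lane rules: no instances, no notation).

## Contents
* `IsParamLiftAt q y` — PARAM-LIFT for a morphism `q : V ⟶ Z` at `y`: `𝔪_{Z, q y} · 𝒪_{V, y}` together with `c` further elements is
  the maximal ideal of `𝒪_{V, y}`, `c = edim_V y − edim_Z (q y)` (embedding dimensions = `spanFinrank` of the maximal ideals, the
  currency of `HasSNCWith`).  This is the typed form of (O3)(iii) «`q` smooth of relative dimension one»: it is exactly what «a simple
  normal crossings family on `Z` pulls back under `q` to one on `V`» consumes, and it holds for flat morphisms with regular fibres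
  between regular schemes.  `IsParamLiftAt.id`.
* `CylState S` — the CYLINDER STATE over `S : MultiHostState X` (p540590): an ABSTRACT carrier `Z` with a closed immersion
  `j : Z ⟶ X` whose ideal `j.ker` is a member of `S.𝓔` (at `k = 1`: `Z = ℙ³_κ = E`; later: the CJS stage — the iso-tolerance of R5ᴴ N3
  is built in), an open `V ⊇ j(Z)` through which `j` factors (`jV`) and which RETRACTS onto `Z` (`q : V ⟶ Z`, `jV ≫ q = 𝟙`), host
  TRACES `tr i` (effective Cartier) and member traces `bd T` on `Z` with the two CYLINDER IDENTITIES `host i|_V = q^*(tr i)` and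
  `T|_V = q^*(bd T)` (`T ∈ S.𝓔` other than the carrier), and PARAM-LIFT for `q` on `V`.
* API: `range_j_subset`, `comap_host_j` (`host i|_Z = tr i`), `comap_member_j` (`T|_Z = bd T`), `centre C` (the pushed centre
  `j(V(C))` as a closed subset of `X`, the `W` of `MultiHostState.step`), `coe_centre`, `centre_subset_range`, `centre_subset_V`.
Module 2 (`CylState.hasSNCWith_centre`, `CylState.lift`: T2a (a)–(e)) follows; signatures: evidence #54 on the crux item.

## References
* E. Bierstone, D. Grigoriev, P. Milman, J. Włodarczyk, *Effective Hironaka resolution and its complexity*, Asian J. Math. 15 (2011),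
  Def. 3.1.1, Def. 3.1.3, Lemma 3.2.1. [BierstoneGrigorievMilmanWlodarczyk2011]
* J. Kollár, *Lectures on Resolution of Singularities* (2007), (3.111) Steps 1–3. [Kollar2007]
* H. Matsumura, *Commutative Ring Theory* (1987), Thm. 23.7 (flat local homomorphisms with regular fibre). [Matsumura1987]
-/

-- `Summit.<Summit>.<Sub>.Theorems` with `Sub = Summit` (single-conjunct summit, D-0017)
set_option linter.dupNamespace false

noncomputable section

open CategoryTheory AlgebraicGeometry TopologicalSpace IsLocalRing
open Literature.AlgebraicGeometry.Resolution
open Scheme.IdealSheafData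

namespace Summit.ResolutionOfSingularities.ResolutionOfSingularities.Theorems.DepthMultiHost

universe u

variable {X : Scheme.{u}}

/-! ## PARAM-LIFT -/

/-- [OURS · L1 W5.2 · F7(β) (O3)(iii)] **PARAM-LIFT for `q : V ⟶ Z` at `y`**: there are finitely many `s ⊆ 𝒪_{V,y}` with
`𝔪_{Z, q y} · 𝒪_{V, y} ⊔ (s) = 𝔪_{V, y}` and `#s + edim_Z (q y) = edim_V y`; hence every regular system of parameters of `𝒪_{Z, q y}` maps
under `q` to PART of a regular system of parameters of `𝒪_{V, y}` (for regular stalks).  Holds for flat local homomorphisms of regular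
local rings with regular fibre. [cite: Matsumura1987, Thm. 23.7] -/
def IsParamLiftAt {V Z : Scheme.{u}} (q : V ⟶ Z) (y : V) : Prop :=
  ∃ s : Finset (V.presheaf.stalk y),
    (maximalIdeal (Z.presheaf.stalk (q y))).map (q.stalkMap y).hom ⊔ Ideal.span (s : Set (V.presheaf.stalk y)) =
      maximalIdeal (V.presheaf.stalk y) ∧
    s.card + (maximalIdeal (Z.presheaf.stalk (q y))).spanFinrank = (maximalIdeal (V.presheaf.stalk y)).spanFinrank

/-- PARAM-LIFT for the identity (no extra parameters). [folklore] -/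
theorem IsParamLiftAt.id (Z : Scheme.{u}) (y : Z) : IsParamLiftAt (𝟙 Z) y := by
  refine ⟨∅, ?_, ?_⟩
  · rw [Finset.coe_empty, Ideal.span_empty, sup_bot_eq, Scheme.Hom.stalkMap_id]
    exact Ideal.map_id _
  · rw [Finset.card_empty, zero_add]
    rfl

/-! ## The cylinder state -/

/-- [OURS · L1 W5.2 · F7(β) (β-AX) (O3)] **CYLINDER STATE** over a multi-host state `S` on `X`: a carrier `j : Z ⟶ X` (closed
immersion, `j.ker ∈ S.𝓔`), a cylinder region `V ⊇ j(Z)` with a RETRACTION `q : V ⟶ Z` (`jV ≫ q = 𝟙`), host traces `tr i`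
(effective Cartier) and member traces `bd T` on `Z` with the CYLINDER IDENTITIES `host i|_V = q^*(tr i)`, `T|_V = q^*(bd T)`
(`T ∈ S.𝓔`, `T ≠ j.ker`), and PARAM-LIFT for `q` at every point of `V`.  At `k = 1`: `V = X₁ = Bl_𝔪 Spec S`, `Z = E = ℙ³_κ`, `q` the
projection through the coefficient field, `host j = q^* V₊(F_j)`. [cite: BierstoneGrigorievMilmanWlodarczyk2011, Def. 3.1.3]
[cite: Kollar2007, (3.111) Step 1] -/
structure CylState (S : MultiHostState X) where
  /-- the abstract carrier -/
  Z : Scheme.{u}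
  /-- its closed immersion into `X` -/
  j : Z ⟶ X
  /-- `j` is a closed immersion -/
  closedImmersion : IsClosedImmersion j
  /-- the carrier's ideal is a member of the state's family -/
  ker_mem : j.ker ∈ S.𝓔
  /-- the cylinder region -/
  V : X.Opens
  /-- the carrier factors through the cylinder region -/
  jV : Z ⟶ (V : Scheme.{u})
  /-- compatibility of the factorisation -/
  jV_ι : jV ≫ V.ι = j
  /-- the retraction of the cylinder region onto the carrier -/
  q : (V : Scheme.{u}) ⟶ Z
  /-- `q` retracts: `jV ≫ q = 𝟙` -/
  retract : jV ≫ q = 𝟙 Z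
  /-- host traces on the carrier -/
  tr : Fin S.n → Z.IdealSheafData
  /-- host traces are effective Cartier -/
  tr_isEffectiveCartier : ∀ i, IsEffectiveCartier (tr i)
  /-- CYLINDER IDENTITY for hosts: `host i|_V = q^*(tr i)` -/
  host_eq : ∀ i, (S.host i).comap V.ι = (tr i).comap q
  /-- member traces on the carrier (junk off `S.𝓔` and at the carrier) -/
  bd : X.IdealSheafData → Z.IdealSheafData
  /-- CYLINDER IDENTITY for members other than the carrier: `T|_V = q^*(bd T)` -/
  member_eq : ∀ T ∈ S.𝓔, T ≠ j.ker → T.comap V.ι = (bd T).comap q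
  /-- `q` lifts parameters at every point of the cylinder region -/
  param : ∀ y : (V : Scheme.{u}), IsParamLiftAt q y

namespace CylState

variable {S : MultiHostState X} (cyl : CylState S)

/-- The carrier lies in the cylinder region. [folklore] -/
theorem range_j_subset : Set.range cyl.j ⊆ (cyl.V : Set X) := by
  rw [← cyl.jV_ι, Scheme.Hom.comp_base, TopCat.coe_comp, Set.range_comp, ← Scheme.Opens.range_ι cyl.V]
  exact Set.image_subset_range _ _

/-- **`host i|_Z = tr i`**: the trace of a host on the carrier IS its trace datum (cylinder identity + retraction). [folklore] -/
theorem comap_host_j (i : Fin S.n) : (S.host i).comap cyl.j = cyl.tr i := by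
  rw [← cyl.jV_ι, Scheme.IdealSheafData.comap_comp, cyl.host_eq i, ← Scheme.IdealSheafData.comap_comp, cyl.retract,
    Scheme.IdealSheafData.comap_id]

/-- **`T|_Z = bd T`** for a member `T` other than the carrier. [folklore] -/
theorem comap_member_j {T : X.IdealSheafData} (hT : T ∈ S.𝓔) (hne : T ≠ cyl.j.ker) : T.comap cyl.j = cyl.bd T := by
  rw [← cyl.jV_ι, Scheme.IdealSheafData.comap_comp, cyl.member_eq T hT hne, ← Scheme.IdealSheafData.comap_comp, cyl.retract,
    Scheme.IdealSheafData.comap_id]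

/-- [OURS · L1 W5.2] **The pushed centre** `W = j(V(C))` of an E-side centre `C` on the carrier, as a closed subset of `X` (the `W` of
`MultiHostState.step`). [cite: Kollar2007, (3.111) Step 1] -/
def centre (C : cyl.Z.IdealSheafData) : Closeds X :=
  haveI := cyl.closedImmersion
  ⟨cyl.j '' (C.support : Set cyl.Z), cyl.j.isClosedEmbedding.isClosedMap _ C.support.isClosed⟩

/-- Unfolding `centre`. [folklore] -/
@[simp] theorem coe_centre (C : cyl.Z.IdealSheafData) : (cyl.centre C : Set X) = cyl.j '' (C.support : Set cyl.Z) := rfl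

/-- The pushed centre lies on the carrier. [folklore] -/
theorem centre_subset_range (C : cyl.Z.IdealSheafData) : (cyl.centre C : Set X) ⊆ Set.range cyl.j := by
  rw [coe_centre]; exact Set.image_subset_range _ _

/-- The pushed centre lies in the cylinder region. [folklore] -/
theorem centre_subset_V (C : cyl.Z.IdealSheafData) : (cyl.centre C : Set X) ⊆ (cyl.V : Set X) :=
  (cyl.centre_subset_range C).trans cyl.range_j_subset

/-- A point of the pushed centre is the image of a point of `V(C)`. [folklore] -/
theorem mem_centre_iff (C : cyl.Z.IdealSheafData) (x : X) :
    x ∈ (cyl.centre C : Set X) ↔ ∃ z : cyl.Z, z ∈ C.support ∧ cyl.j z = x := by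
  rw [coe_centre, Set.mem_image]; rfl

end CylState

end Summit.ResolutionOfSingularities.ResolutionOfSingularities.Theorems.DepthMultiHost

end
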